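import Literature.MathematicalPhysics.QuantumFieldTheory.Balaban1983to89.B6MultiLevelTorusMirrorMajorant

/-!
# `Balaban1983to89.B6MultiLevelTorusMirrorImageFold` — [Balaban1983RegularityDecay] (2.42) p. 584 «Using this representation it is enough to prove (2.35), (2.36) for
# the propagator G_j»: THE FOLD OF A BLOCK MAJORANT ALONG THE SIGNED IMAGE SUM, for ANY operator on the member's torus whose rows are signed image sums of a kernel on the
# doubled torus (source images or target images), and the two MIRROR CANCELLATIONS — the tool for the entries (2.67)₂,₃,₆ of [Balaban1984PropagatorsII] Prop. 2.2 ∕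
# [Balaban1985BackgroundPropagators] Thm 3.1 (3.42) at `U = 1` of the Dirichlet cube letter (ROAD (I) «IMAGES», file D3e-α)

FRAMING (verbatim cell line):
statement-level skeleton of published theorems with citation tags; proofs where landed; nothing here is a claim about the Yang–Mills mass gap

Sources: T. Bałaban, *Regularity and decay of lattice Green's functions*, Commun. Math. Phys. **89** (1983) 571–597 [`Balaban1983RegularityDecay`], (2.42) p. 584 (the
multiple reflection representation and «Using this representation it is enough to prove (2.35), (2.36) for the propagator G_j»); T. Bałaban, *Propagators and
renormalization transformations for lattice gauge theories. II*, Commun. Math. Phys. **96** (1984) 223–250 [`Balaban1984PropagatorsII`], (2.51) p. 232, Prop. 2.2 (2.67)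
p. 234; T. Bałaban, *Propagators for lattice gauge theories in a background field*, Commun. Math. Phys. **99** (1985) 389–434 [`Balaban1985BackgroundPropagators`], p. 394,
Thm 3.1 (3.42) p. 397, p. 409 l. 1–5.  Unit `pub-ymgap-dag-n06-c` (g31).

## WHAT THIS FILE CERTIFIES (kernel-checked; `η = 1`, `L = ℓ + 1`)

Doubled torus `N′` with the mirror data of D2b (`trefl`, `tsign`, `mirIdx`, open ∕ closed mirror boxes `X ⊂ X̄`), a `…L0` family `F` on the member's torus `N₀`, its
reflected family `F′`, the embedding `emb`, the transfer map `Ψ` (D3d):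
* §1 THE MIRROR CANCELLATIONS for any kernel `G` on the doubled torus: `sum_images_eq_zero_of_snd_fixed` (a signed image sum `Σ_ε (−1)^{#ε}G(x, σ_ε y)` VANISHES when `y`
  lies on a mirror — free), `sum_images_eq_zero_of_fst_fixed` (… when `x` lies on a mirror, for `G` invariant under that face reflection — D1
  `sum_sign_mul_apply_perm_eq_zero`), `exists_single_fixed_of_mem_closed_not_mem_open` (the sites of `X̄ ∖ X` lie on a mirror), `images_switch` (for a jointly
  invariant `G`, `G(x, σ_ε y) = G(σ_ε x, y)`), `gmlT_reflected_trefl` (the torus Green's function of the reflected family IS jointly invariant);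
* §2 ★★★ THE FOLDS `hasMajorant_of_sourceImages` ∕ `hasMajorant_of_targetImages`: if an operator `T` on the functions of the member's torus vanishes at the rows off
  `emb(X_r)` and at the row `emb x` (`x ∈ X_r ⊂ X̄`) equals `Σ_ε (−1)^{#ε}(G♯λ_ε)(x)` with `λ_ε = f̃ ∘ σ_ε` (SOURCE images) — resp. `Σ_ε (−1)^{#ε}(G♯f̃)(σ_ε x)` (TARGET
  images) — where `f̃` is the pull-back of `f` to a set `Y ⊂ X̄` of the closed box, and `G♯` has the block majorant `φ(j(y))e^{−δd_{F′}(y,y′)}` over the reflected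
  family, then `T` has the block majorant `#(mirIdx)·φ(j(y))·e^{−δ d_F(y,y′)}` over `F` (blocks `blkOf F`): the pull-back of a block-supported datum is block-supported
  (D3d′ `blkOf_eq_iff_blkOf_emb_eq` on the closed box), each image term is bounded by the hypothesis, levels agree (`levR_of_mem_closed`, `levR_trefl`) and the
  distance folds (`dist_blkPsi_le`, `blkPsi_trefl`, `blkPsi_blkOf_of_mem_closed`).

## HONEST SCOPE

Bookkeeping over D1–D3d′; no estimate is produced, one is transported per image and summed.  The instances (forward ∕ backward differences and the Laplacian of the
Dirichlet cube letter, with their boundary rows) are file D3e-β.  Nothing continuum ∕ OS ∕ Clay; N06 is not discharged by this file; the YM mass gap is not proved by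
any of this.
-/

namespace Literature.MathematicalPhysics.QuantumFieldTheory.Balaban1983to89.B6MultiLevelTorusMirrorImageFold

noncomputable section

open Finset
open scoped Matrix
open Literature.MathematicalPhysics.QuantumFieldTheory.Balaban1983to89.B4Reflection242 (boxDom mem_boxDom blk)
open Literature.MathematicalPhysics.QuantumFieldTheory.Balaban1983to89.B6MultiLevelBoxOperator (N0 bigSide one_le_bigSide)
open Literature.MathematicalPhysics.QuantumFieldTheory.Balaban1983to89.B6MultiLevelTorusOperator (twrap tshift mlOpT gmlT mlOpT_mul_gmlT one_le_of_mem one_le_N0)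
open Literature.MathematicalPhysics.QuantumFieldTheory.Balaban1983to89.B6MultiLevelTorusOperatorL0 (TDomains)
open Literature.MathematicalPhysics.QuantumFieldTheory.Balaban1983to89.B6Geom246MultiLevelBoxL0 (bset blkOf blkOf_val exists_blkOf_eq)
open Literature.MathematicalPhysics.QuantumFieldTheory.Balaban1983to89.B6Geom246MultiLevelTorusL0 (bondT geomT)
open Literature.MathematicalPhysics.QuantumFieldTheory.Balaban1983to89.B6RandomWalk (HasMajorant BlockSupp)
open Literature.MathematicalPhysics.QuantumFieldTheory.Balaban1983to89.B4Eq242TorusMirrors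
open Literature.MathematicalPhysics.QuantumFieldTheory.Balaban1983to89.B6MultiLevelTorusMirrorL0
open Literature.MathematicalPhysics.QuantumFieldTheory.Balaban1983to89.B6MultiLevelTorusMirrorDirichlet
open Literature.MathematicalPhysics.QuantumFieldTheory.Balaban1983to89.B6MultiLevelTorusMirrorCompression
open Literature.MathematicalPhysics.QuantumFieldTheory.Balaban1983to89.B6MultiLevelTorusMirrorDecay
open Literature.MathematicalPhysics.QuantumFieldTheory.Balaban1983to89.B6MultiLevelTorusMirrorMajorant
open Literature.MathematicalPhysics.QuantumFieldTheory.Balaban1983to89.B4Eq242SignedImages (sum_sign_mul_apply_perm_eq_zero submatrix_perm_eq_of_mul_eq_one)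

variable {d : ℕ}

/-! ## §1  The mirror cancellations and the switch of images -/

section Cancel

variable {N : Fin (d + 1) → ℕ} {mir : Fin (d + 1) → Bool} {n h : Fin (d + 1) → ℤ}
  {hmir : ∀ μ, mir μ = true → (N μ : ℤ) = 2 * n μ ∧ 0 ≤ h μ ∧ h μ < n μ ∧ 2 ≤ n μ}

/-- the face reflections commute: `σ_{flip_μ ε} = σ_ε ∘ σ_μ`. [cite: Balaban1983RegularityDecay, (2.42) p.584, bookkeeping] -/
theorem trefl_flipAt_apply (μ : Fin (d + 1)) (ε : Fin (d + 1) → Bool) (y : ↥(boxDom N)) :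
    trefl hmir (flipAt μ ε) y = trefl hmir ε (trefl hmir (single μ) y) := by
  have h1 : trefl hmir (flipAt μ ε) = trefl hmir ε * trefl hmir (single μ) := by
    rw [trefl_mul, flipAt_eq_xor]
    congr 1; funext ν; cases single μ ν <;> cases ε ν <;> rfl
  rw [h1, Equiv.Perm.mul_apply]

/-- `flip_μ ε ≠ ε`. [cite: Balaban1983RegularityDecay, (2.42) p.584, bookkeeping] -/
theorem flipAt_ne (μ : Fin (d + 1)) (ε : Fin (d + 1) → Bool) : flipAt μ ε ≠ ε := by
  intro hc
  have := congrFun hc μ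
  unfold flipAt at this
  rw [Function.update_self] at this
  cases hε : ε μ <;> rw [hε] at this <;> simp at this

/-- ★ **SECOND-ARGUMENT CANCELLATION (free)**: if `y` is fixed by the face reflection `σ_μ` of a mirrored direction, then `Σ_ε (−1)^{#ε} G(x, σ_ε y) = 0` for EVERY kernel `G`
(the images `σ_ε y` and `σ_{flip_μ ε} y` coincide and carry opposite signs). [cite: Balaban1983RegularityDecay, (2.42) p.584] -/
theorem sum_images_eq_zero_of_snd_fixed (G : Matrix ↥(boxDom N) ↥(boxDom N) ℝ) {μ : Fin (d + 1)} (hμ : mir μ = true)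
    {y : ↥(boxDom N)} (hy : trefl hmir (single μ) y = y) (x : ↥(boxDom N)) :
    ∑ ε ∈ mirIdx mir, tsign ℝ mir ε * G x (trefl hmir ε y) = 0 := by
  refine Finset.sum_involution (fun ε _ => flipAt μ ε) ?_ ?_ ?_ ?_
  · intro ε _
    rw [trefl_flipAt_apply, hy, tsign_flipAt hμ]; ring
  · intro ε _ _; exact flipAt_ne μ ε
  · intro ε hε; exact flipAt_mem_mirIdx hμ hε
  · intro ε _; exact flipAt_flipAt μ ε

/-- ★ **FIRST-ARGUMENT CANCELLATION**: if `x` is fixed by the face reflection `σ_μ` and `G` is invariant under it, then `Σ_ε (−1)^{#ε} G(x, σ_ε y) = 0` for every `y` (D1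
`sum_sign_mul_apply_perm_eq_zero` at the index involution `flip_μ`). [cite: Balaban1983RegularityDecay, (2.42) p.584] -/
theorem sum_images_eq_zero_of_fst_fixed (hN : ∀ μ, 1 ≤ N μ) (G : Matrix ↥(boxDom N) ↥(boxDom N) ℝ) {μ : Fin (d + 1)} (hμ : mir μ = true)
    (hG : ∀ u w, G (trefl hmir (single μ) u) (trefl hmir (single μ) w) = G u w) {x : ↥(boxDom N)} (hx : trefl hmir (single μ) x = x) (y : ↥(boxDom N)) :
    ∑ ε ∈ mirIdx mir, tsign ℝ mir ε * G x (trefl hmir ε y) = 0 :=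
  sum_sign_mul_apply_perm_eq_zero (mirIdx mir) (trefl hmir) (tsign ℝ mir) G (trefl_single_ne_one hN hmir hμ) hG (flipAt μ)
    (fun ε hε => ⟨flipAt_mem_mirIdx hμ hε, trefl_flipAt hmir μ ε, tsign_flipAt hμ ε, flipAt_flipAt μ ε⟩) hx y

/-- THE SITES OF `X̄ ∖ X` LIE ON A MIRROR: such a site is fixed by the face reflection of some mirrored direction. [cite: Balaban1983RegularityDecay, (2.42) p.584, dictionary] -/
theorem exists_single_fixed_of_mem_closed_not_mem_open {y : ↥(boxDom N)} (hyc : y ∈ mirBoxClosed N mir n h) (hyo : y ∉ mirBoxOpen N mir n h) :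
    ∃ μ, mir μ = true ∧ trefl hmir (single μ) y = y := by
  rw [mirBoxClosed, Finset.mem_filter] at hyc
  rw [mirBoxOpen, Finset.mem_filter] at hyo
  have hyo' : ¬ ∀ μ, mir μ = true → h μ < y.1 μ ∧ y.1 μ < h μ + n μ := fun hc => hyo ⟨Finset.mem_univ _, hc⟩
  obtain ⟨μ, hμ'⟩ := not_forall.1 hyo'
  obtain ⟨hm, hyμ⟩ := Classical.not_imp.1 hμ'
  obtain ⟨h1, h2⟩ := hyc.2 μ hm
  obtain ⟨-, h0, hn, -⟩ := hmir μ hm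
  refine ⟨μ, hm, Subtype.ext (funext fun ν => ?_)⟩
  rw [trefl_apply_val]
  by_cases hν : ν = μ
  · subst hν
    have hs : (B4Eq242TorusMirrors.single ν ν && mir ν) = true := by unfold B4Eq242TorusMirrors.single; simp [hm]
    rw [if_pos hs, mref_eq_self_iff h0 hn]
    omega
  · have hs : ¬ (B4Eq242TorusMirrors.single μ ν && mir ν) = true := by unfold B4Eq242TorusMirrors.single; simp [Function.update_of_ne hν]
    rw [if_neg hs]

/-- ★ THE SWITCH OF IMAGES: for a kernel jointly invariant under the face reflections, `G(x, σ_ε y) = G(σ_ε x, y)` (`σ_ε` is an involution).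
[cite: Balaban1983RegularityDecay, (2.42) p.584, bookkeeping] -/
theorem images_switch (G : Matrix ↥(boxDom N) ↥(boxDom N) ℝ) (hG : ∀ ε u w, G (trefl hmir ε u) (trefl hmir ε w) = G u w) (ε : Fin (d + 1) → Bool)
    (x y : ↥(boxDom N)) : G x (trefl hmir ε y) = G (trefl hmir ε x) y := by
  have hinv : trefl hmir ε (trefl hmir ε y) = y := by
    have : trefl hmir ε * trefl hmir ε = 1 := by
      rw [trefl_mul]
      have : (fun μ => xor (ε μ) (ε μ)) = fun _ => false := funext fun μ => Bool.xor_self _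
      rw [this, trefl_bot]
    have h := congrArg (fun σ : Equiv.Perm ↥(boxDom N) => σ y) this
    simpa using h
  rw [← hG ε x (trefl hmir ε y), hinv]

end Cancel

section Invariance

variable {ℓ Mh k R : ℕ} {P : Fin (d + 1) → ℕ} {k' : ℕ} {mir : Fin (d + 1) → Bool} {m : Fin (d + 1) → ℕ} {g : Fin (d + 1) → ℤ}
  {F : TDomains d ℓ Mh k P R} {hL : Odd (ℓ + 1)} {hM : Odd Mh} {hMh : 1 ≤ Mh} {hP : ∀ μ, 1 ≤ P μ} {hk : k' ≤ k} {hlev : ∀ x, F.lev x ≤ k'}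
  {hm : ∀ μ, mir μ = true → 2 ≤ m μ} {hg : ∀ μ, sTop ℓ Mh k' ∣ g μ}

/-- ★ THE TORUS GREEN's FUNCTION OF THE REFLECTED FAMILY IS JOINTLY INVARIANT under every face reflection (its operator is, D3a `mlOpT_reflected_trefl`; D1
`submatrix_perm_eq_of_mul_eq_one`). [cite: Balaban1983RegularityDecay, (2.42) p.584; Balaban1984PropagatorsII, p.225 («G′ = Δ′_a^{−1}»)] -/
theorem gmlT_reflected_trefl (a : ℕ → ℝ) (ha : ∀ j, 0 < a j) (ε : Fin (d + 1) → Bool) (u w : ↥(boxDom (N0 ℓ Mh k' (Pref ℓ k k' P mir m)))) :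
    gmlT (N0 ℓ Mh k' (Pref ℓ k k' P mir m)) ℓ k' (reflected F k' mir m g hL hM hMh hP hk hlev hm hg).lev a (trefl (hmir_of_top (k := k) (k' := k') (P := P) hL hM hMh hm) ε u)
        (trefl (hmir_of_top (k := k) (k' := k') (P := P) hL hM hMh hm) ε w) =
      gmlT (N0 ℓ Mh k' (Pref ℓ k k' P mir m)) ℓ k' (reflected F k' mir m g hL hM hMh hP hk hlev hm hg).lev a u w :=
  submatrix_perm_eq_of_mul_eq_one
    (mlOpT_mul_gmlT (one_le_N0_Pref (k := k) (k' := k') (P := P) hMh hP hm) (reflected F k' mir m g hL hM hMh hP hk hlev hm hg).lev_le ha)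
    (fun u w => mlOpT_reflected_trefl (hL := hL) (hM := hM) (hMh := hMh) (hP := hP) (hk := hk) (hlev := hlev) (hm := hm) (hg := hg) a ε u w) u w

end Invariance

/-! ## §2  The folds -/

section Fold

variable {ℓ Mh k R : ℕ} {P : Fin (d + 1) → ℕ} {k' : ℕ} {mir : Fin (d + 1) → Bool} {m : Fin (d + 1) → ℕ} {g : Fin (d + 1) → ℤ}
  {F : TDomains d ℓ Mh k P R} {hL : Odd (ℓ + 1)} {hM : Odd Mh} {hMh : 1 ≤ Mh} {hP : ∀ μ, 1 ≤ P μ} {hk : k' ≤ k} {hlev : ∀ x, F.lev x ≤ k'}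
  {hm : ∀ μ, mir μ = true → 2 ≤ m μ} {hg : ∀ μ, sTop ℓ Mh k' ∣ g μ}

open Classical in
/-- THE PULL-BACK of a function of the member's torus to a set `Y` of sites of the doubled torus: `f̃(y) = f(emb y)` on `Y`, `0` off `Y`.
[cite: Balaban1983RegularityDecay, (2.42) p.584, dictionary] -/
def pullY (hMh : 1 ≤ Mh) (hP : ∀ μ, 1 ≤ P μ) (g : Fin (d + 1) → ℤ) (Y : Finset ↥(boxDom (N0 ℓ Mh k' (Pref ℓ k k' P mir m))))
    (f : ↥(boxDom (N0 ℓ Mh k P)) → ℝ) : ↥(boxDom (N0 ℓ Mh k' (Pref ℓ k k' P mir m))) → ℝ :=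
  fun y => if y ∈ Y then f ⟨B6MultiLevelTorusMirrorL0.emb (ℓ := ℓ) (Mh := Mh) (k := k) (P := P) g y.1, emb_mem hMh hP g y.1⟩ else 0

/-- the pull-back on `Y`. [cite: Balaban1983RegularityDecay, (2.42) p.584, bookkeeping] -/
theorem pullY_of_mem {Y : Finset ↥(boxDom (N0 ℓ Mh k' (Pref ℓ k k' P mir m)))} (f : ↥(boxDom (N0 ℓ Mh k P)) → ℝ)
    {y : ↥(boxDom (N0 ℓ Mh k' (Pref ℓ k k' P mir m)))} (hy : y ∈ Y) :
    pullY (k := k) (P := P) hMh hP g Y f y = f ⟨B6MultiLevelTorusMirrorL0.emb (ℓ := ℓ) (Mh := Mh) (k := k) (P := P) g y.1, emb_mem hMh hP g y.1⟩ := by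
  unfold pullY; rw [if_pos hy]

/-- the pull-back off `Y`. [cite: Balaban1983RegularityDecay, (2.42) p.584, bookkeeping] -/
theorem pullY_of_not_mem {Y : Finset ↥(boxDom (N0 ℓ Mh k' (Pref ℓ k k' P mir m)))} (f : ↥(boxDom (N0 ℓ Mh k P)) → ℝ)
    {y : ↥(boxDom (N0 ℓ Mh k' (Pref ℓ k k' P mir m)))} (hy : y ∉ Y) :
    pullY (k := k) (P := P) hMh hP g Y f y = 0 := by
  unfold pullY; rw [if_neg hy]

/-- ★ THE PULL-BACK OF A BLOCK-SUPPORTED DATUM IS BLOCK-SUPPORTED in the reflected family (for `Y ⊂ X̄`): if `f` is supported in the block `y′` of `F` and bounded by `B`,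
then `f̃` vanishes identically or is supported in ONE block `t′` of `F′` with `Ψ t′ = y′`, bounded by `B`.
[cite: Balaban1984PropagatorsII, (2.51) p.232 («supp λ ⊂ B^{j′}(y′)»); Balaban1983RegularityDecay, (2.42) p.584] -/
theorem blockSupp_pullY (hfit : ∀ μ, mir μ = true → nMir ℓ Mh k' m μ + sTop ℓ Mh k' ≤ (N0 ℓ Mh k P μ : ℤ))
    {Y : Finset ↥(boxDom (N0 ℓ Mh k' (Pref ℓ k k' P mir m)))}
    (hY : Y ⊆ mirBoxClosed (N0 ℓ Mh k' (Pref ℓ k k' P mir m)) mir (nMir ℓ Mh k' m) (fun _ => hMir ℓ Mh k'))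
    {y' : ↥(bset F.toDomains)} {f : ↥(boxDom (N0 ℓ Mh k P)) → ℝ} {B : ℝ}
    (hf : BlockSupp (g := geomT F) (blkOf F.toDomains) f y' B)
    {y₀ : ↥(boxDom (N0 ℓ Mh k' (Pref ℓ k k' P mir m)))} (hy₀ : y₀ ∈ Y) (hfy₀ : pullY (k := k) (P := P) hMh hP g Y f y₀ ≠ 0) :
    BlockSupp (g := geomT (reflected F k' mir m g hL hM hMh hP hk hlev hm hg)) (blkOf (reflected F k' mir m g hL hM hMh hP hk hlev hm hg).toDomains)
        (pullY (k := k) (P := P) hMh hP g Y f) (blkOf (reflected F k' mir m g hL hM hMh hP hk hlev hm hg).toDomains y₀) B ∧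
      blkPsi F k' mir m g hL hM hMh hP hk hlev hm hg (blkOf (reflected F k' mir m g hL hM hMh hP hk hlev hm hg).toDomains y₀) = y' := by
  have hy₀' : blkOf F.toDomains ⟨B6MultiLevelTorusMirrorL0.emb (ℓ := ℓ) (Mh := Mh) (k := k) (P := P) g y₀.1, emb_mem hMh hP g y₀.1⟩ = y' := by
    by_contra hne
    rw [pullY_of_mem f hy₀] at hfy₀
    exact hfy₀ (hf.off _ hne)
  refine ⟨⟨hf.nonneg, fun y _ => ?_, fun y hy => ?_⟩, ?_⟩
  · by_cases hyY : y ∈ Y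
    · rw [pullY_of_mem f hyY]
      by_cases hb : blkOf F.toDomains ⟨B6MultiLevelTorusMirrorL0.emb (ℓ := ℓ) (Mh := Mh) (k := k) (P := P) g y.1, emb_mem hMh hP g y.1⟩ = y'
      · exact hf.bound _ hb
      · rw [hf.off _ hb, abs_zero]; exact hf.nonneg
    · rw [pullY_of_not_mem f hyY, abs_zero]; exact hf.nonneg
  · by_cases hyY : y ∈ Y
    · rw [pullY_of_mem f hyY]
      apply hf.off
      intro hb
      apply hy
      exact (blkOf_eq_iff_blkOf_emb_eq (hL := hL) (hM := hM) (hMh := hMh) (hP := hP) (hk := hk) (hlev := hlev) (hm := hm) (hg := hg) hfit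
        (hY hyY) (hY hy₀)).2 (hb.trans hy₀'.symm)
    · exact pullY_of_not_mem f hyY
  · rw [blkPsi_blkOf_of_mem_closed (hY hy₀), hy₀']

/-- ★★★ **THE FOLD ALONG SOURCE IMAGES**: an operator `T` on the member's torus whose rows off `emb(X_r)` vanish and whose row at `emb x`, `x ∈ X_r ⊂ X̄`, is the signed image sum
`Σ_ε (−1)^{#ε}(G♯(f̃ ∘ σ_ε))(x)` of a kernel `G♯` of the doubled torus with block majorant `φ(j(y))e^{−δ d_{F′}}`, has the block majorant `#(mirIdx)·φ(j(y))·e^{−δ d_F}` over `F`.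
[cite: Balaban1983RegularityDecay, (2.42) p.584 («Using this representation it is enough to prove (2.35), (2.36) for the propagator G_j»); Balaban1984PropagatorsII, (2.51) p.232, Prop. 2.2 (2.67) p.234; Balaban1985BackgroundPropagators, Thm 3.1 (3.42) p.397, p.409 l.1–5] -/
theorem hasMajorant_of_sourceImages
    (hfit : ∀ μ, mir μ = true → nMir ℓ Mh k' m μ + sTop ℓ Mh k' ≤ (N0 ℓ Mh k P μ : ℤ))
    (Xr Y : Finset ↥(boxDom (N0 ℓ Mh k' (Pref ℓ k k' P mir m))))
    (hXr : Xr ⊆ mirBoxClosed (N0 ℓ Mh k' (Pref ℓ k k' P mir m)) mir (nMir ℓ Mh k' m) (fun _ => hMir ℓ Mh k'))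
    (hY : Y ⊆ mirBoxClosed (N0 ℓ Mh k' (Pref ℓ k k' P mir m)) mir (nMir ℓ Mh k' m) (fun _ => hMir ℓ Mh k'))
    (G : Matrix ↥(boxDom (N0 ℓ Mh k' (Pref ℓ k k' P mir m))) ↥(boxDom (N0 ℓ Mh k' (Pref ℓ k k' P mir m))) ℝ)
    {φ : ℕ → ℝ} (hφ : ∀ j, 0 ≤ φ j) {δ : ℝ} (hδ : 0 ≤ δ)
    (hG : HasMajorant (g := geomT (reflected F k' mir m g hL hM hMh hP hk hlev hm hg)) (blkOf (reflected F k' mir m g hL hM hMh hP hk hlev hm hg).toDomains)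
      (Matrix.toLin' G) (fun y y' => φ y.1.1 * Real.exp (-(δ * (geomT (reflected F k' mir m g hL hM hMh hP hk hlev hm hg)).dist y y'))))
    (T : Module.End ℝ (↥(boxDom (N0 ℓ Mh k P)) → ℝ))
    (hrow : ∀ f (z : ↥(boxDom (N0 ℓ Mh k P))), (∀ x ∈ Xr, B6MultiLevelTorusMirrorL0.emb (ℓ := ℓ) (Mh := Mh) (k := k) (P := P) g x.1 ≠ z.1) → T f z = 0)
    (hsrc : ∀ f, ∀ x ∈ Xr, T f ⟨B6MultiLevelTorusMirrorL0.emb (ℓ := ℓ) (Mh := Mh) (k := k) (P := P) g x.1, emb_mem hMh hP g x.1⟩ =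
      ∑ ε ∈ mirIdx mir, tsign ℝ mir ε * (G *ᵥ (fun w => pullY (k := k) (P := P) hMh hP g Y f (trefl (hmir_of_top (k := k) (k' := k') (P := P) hL hM hMh hm) ε w))) x) :
    HasMajorant (g := geomT F) (blkOf F.toDomains) T (fun y y' => (mirIdx mir).card * φ y.1.1 * Real.exp (-(δ * (geomT F).dist y y'))) := by
  classical
  intro y' f B hf z
  have hRHS : 0 ≤ (mirIdx mir).card * φ (blkOf F.toDomains z).1.1 * Real.exp (-(δ * (geomT F).dist (blkOf F.toDomains z) y')) * B :=
    mul_nonneg (mul_nonneg (mul_nonneg (Nat.cast_nonneg _) (hφ _)) (Real.exp_nonneg _)) hf.nonneg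
  by_cases hz : ∃ x ∈ Xr, B6MultiLevelTorusMirrorL0.emb (ℓ := ℓ) (Mh := Mh) (k := k) (P := P) g x.1 = z.1
  swap
  · rw [hrow f z (fun x hx he => hz ⟨x, hx, he⟩), abs_zero]; exact hRHS
  obtain ⟨x, hx, hxz⟩ := hz
  have hz' : z = ⟨B6MultiLevelTorusMirrorL0.emb (ℓ := ℓ) (Mh := Mh) (k := k) (P := P) g x.1, emb_mem hMh hP g x.1⟩ := Subtype.ext hxz.symm
  subst hz'
  rw [hsrc f x hx]
  -- the trivial datum
  by_cases h0 : ∀ y ∈ Y, pullY (k := k) (P := P) hMh hP g Y f y = 0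
  · have hzero : (pullY (k := k) (P := P) hMh hP g Y f) = 0 := by
      funext y; by_cases hy : y ∈ Y
      · exact h0 y hy
      · exact pullY_of_not_mem f hy
    have hsum : ∑ ε ∈ mirIdx mir, tsign ℝ mir ε * (G *ᵥ (fun w => pullY (k := k) (P := P) hMh hP g Y f (trefl (hmir_of_top (k := k) (k' := k') (P := P) hL hM hMh hm) ε w))) x = 0 := by
      refine Finset.sum_eq_zero fun ε _ => ?_
      have : (fun w => pullY (k := k) (P := P) hMh hP g Y f (trefl (hmir_of_top (k := k) (k' := k') (P := P) hL hM hMh hm) ε w)) = 0 := by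
        funext w; rw [hzero]; rfl
      rw [this, Matrix.mulVec_zero, Pi.zero_apply, mul_zero]
    rw [hsum, abs_zero]; exact hRHS
  obtain ⟨y₀, hy₀, hfy₀⟩ : ∃ y₀ ∈ Y, pullY (k := k) (P := P) hMh hP g Y f y₀ ≠ 0 := by
    by_contra hc; push Not at hc; exact h0 hc
  obtain ⟨hbs, hΨ⟩ := blockSupp_pullY (hL := hL) (hM := hM) (hMh := hMh) (hP := hP) (hk := hk) (hlev := hlev) (hm := hm) (hg := hg) hfit hY hf hy₀ hfy₀
  set t' := blkOf (reflected F k' mir m g hL hM hMh hP hk hlev hm hg).toDomains y₀ with ht'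
  set s := blkOf (reflected F k' mir m g hL hM hMh hP hk hlev hm hg).toDomains x with hs
  -- levels and the folded distance at the row
  have hxc := hXr hx
  have hlev_eq : s.1.1 = (blkOf F.toDomains ⟨B6MultiLevelTorusMirrorL0.emb (ℓ := ℓ) (Mh := Mh) (k := k) (P := P) g x.1, emb_mem hMh hP g x.1⟩).1.1 := by
    rw [hs]; simp only [blkOf_val, TDomains.toDomains_lev, reflected_lev]; exact levR_of_mem_closed hxc
  have hterm : ∀ ε ∈ mirIdx mir, |tsign ℝ mir ε * (G *ᵥ (fun w => pullY (k := k) (P := P) hMh hP g Y f (trefl (hmir_of_top (k := k) (k' := k') (P := P) hL hM hMh hm) ε w))) x| ≤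
      φ (blkOf F.toDomains ⟨B6MultiLevelTorusMirrorL0.emb (ℓ := ℓ) (Mh := Mh) (k := k) (P := P) g x.1, emb_mem hMh hP g x.1⟩).1.1 *
        Real.exp (-(δ * (geomT F).dist (blkOf F.toDomains ⟨B6MultiLevelTorusMirrorL0.emb (ℓ := ℓ) (Mh := Mh) (k := k) (P := P) g x.1, emb_mem hMh hP g x.1⟩) y')) * B := by
    intro ε _
    -- `λ_ε = f̃ ∘ σ_ε` is supported in the block `σ_ε t′` (`σ_ε` is an involution)
    set lam : ↥(boxDom (N0 ℓ Mh k' (Pref ℓ k k' P mir m))) → ℝ := fun w => pullY (k := k) (P := P) hMh hP g Y f (trefl (hmir_of_top (k := k) (k' := k') (P := P) hL hM hMh hm) ε w) with hlam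
    set t := blkOf (reflected F k' mir m g hL hM hMh hP hk hlev hm hg).toDomains (trefl (hmir_of_top (k := k) (k' := k') (P := P) hL hM hMh hm) ε y₀) with ht
    have hinv : ∀ w : ↥(boxDom (N0 ℓ Mh k' (Pref ℓ k k' P mir m))), trefl (hmir_of_top (k := k) (k' := k') (P := P) hL hM hMh hm) ε (trefl (hmir_of_top (k := k) (k' := k') (P := P) hL hM hMh hm) ε w) = w := by
      intro w
      have : trefl (hmir_of_top (k := k) (k' := k') (P := P) hL hM hMh hm) ε * trefl (hmir_of_top (k := k) (k' := k') (P := P) hL hM hMh hm) ε = 1 := by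
        rw [trefl_mul]
        have : (fun μ => xor (ε μ) (ε μ)) = fun _ => false := funext fun μ => Bool.xor_self _
        rw [this, trefl_bot]
      have h := congrArg (fun σ : Equiv.Perm ↥(boxDom (N0 ℓ Mh k' (Pref ℓ k k' P mir m))) => σ w) this
      simpa using h
    have hbs' : BlockSupp (g := geomT (reflected F k' mir m g hL hM hMh hP hk hlev hm hg)) (blkOf (reflected F k' mir m g hL hM hMh hP hk hlev hm hg).toDomains) lam t B := by
      refine ⟨hf.nonneg, fun w _ => ?_, fun w hw => ?_⟩
      · -- bound: `|λ_ε w| = |f̃(σ_ε w)| ≤ B`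
        rw [hlam]; simp only
        by_cases hb : blkOf (reflected F k' mir m g hL hM hMh hP hk hlev hm hg).toDomains (trefl (hmir_of_top (k := k) (k' := k') (P := P) hL hM hMh hm) ε w) = t'
        · exact hbs.bound _ hb
        · rw [hbs.off _ hb, abs_zero]; exact hf.nonneg
      · rw [hlam]; simp only
        apply hbs.off
        intro hb
        apply hw
        rw [ht]
        have := blkOf_trefl_eq_of_blkOf_eq (F := F) (hL := hL) (hM := hM) (hMh := hMh) (hP := hP) (hk := hk) (hlev := hlev) (hm := hm) (hg := hg) ε hb
        rw [hinv] at this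
        exact this
    have hc := hG t lam B hbs' x
    rw [Matrix.toLin'_apply] at hc
    -- fold the distance: `d_F(blk(emb x), y′) = d_F(Ψ s, Ψ t) ≤ d_{F′}(s, t)`
    have hd : (geomT F).dist (blkOf F.toDomains ⟨B6MultiLevelTorusMirrorL0.emb (ℓ := ℓ) (Mh := Mh) (k := k) (P := P) g x.1, emb_mem hMh hP g x.1⟩) y' ≤
        (geomT (reflected F k' mir m g hL hM hMh hP hk hlev hm hg)).dist s t := by
      have h1 := dist_blkPsi_le (F := F) (hL := hL) (hM := hM) (hMh := hMh) (hP := hP) (hk := hk) (hlev := hlev) (hm := hm) (hg := hg) s t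
      rw [hs, ht, blkPsi_blkOf_of_mem_closed hxc, blkPsi_trefl, hΨ] at h1
      show ((bondT F).dist _ y' : ℝ) ≤ ((bondT (reflected F k' mir m g hL hM hMh hP hk hlev hm hg)).dist s t : ℝ)
      rw [hs, ht]
      exact_mod_cast h1
    rw [abs_mul]
    calc |tsign ℝ mir ε| * |(G *ᵥ lam) x| ≤ 1 * (φ s.1.1 * Real.exp (-(δ * (geomT (reflected F k' mir m g hL hM hMh hP hk hlev hm hg)).dist s t)) * B) :=
          mul_le_mul (abs_tsign_le ε) hc (abs_nonneg _) zero_le_one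
      _ ≤ _ := by
          rw [one_mul, ← hlev_eq]
          apply mul_le_mul_of_nonneg_right _ hf.nonneg
          apply mul_le_mul_of_nonneg_left _ (hφ _)
          apply Real.exp_le_exp.2
          have := mul_le_mul_of_nonneg_left hd hδ
          linarith
  calc |∑ ε ∈ mirIdx mir, tsign ℝ mir ε * (G *ᵥ (fun w => pullY (k := k) (P := P) hMh hP g Y f (trefl (hmir_of_top (k := k) (k' := k') (P := P) hL hM hMh hm) ε w))) x|
      ≤ ∑ ε ∈ mirIdx mir, |tsign ℝ mir ε * (G *ᵥ (fun w => pullY (k := k) (P := P) hMh hP g Y f (trefl (hmir_of_top (k := k) (k' := k') (P := P) hL hM hMh hm) ε w))) x| :=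
        Finset.abs_sum_le_sum_abs _ _
    _ ≤ ∑ ε ∈ mirIdx mir, φ (blkOf F.toDomains ⟨B6MultiLevelTorusMirrorL0.emb (ℓ := ℓ) (Mh := Mh) (k := k) (P := P) g x.1, emb_mem hMh hP g x.1⟩).1.1 *
        Real.exp (-(δ * (geomT F).dist (blkOf F.toDomains ⟨B6MultiLevelTorusMirrorL0.emb (ℓ := ℓ) (Mh := Mh) (k := k) (P := P) g x.1, emb_mem hMh hP g x.1⟩) y')) * B :=
        Finset.sum_le_sum hterm
    _ = _ := by rw [Finset.sum_const, nsmul_eq_mul]; ring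

/-- ★★★ **THE FOLD ALONG TARGET IMAGES**: the same for an operator whose row at `emb x`, `x ∈ X_r ⊂ X̄`, is `Σ_ε (−1)^{#ε}(G♯ f̃)(σ_ε x)` (the images act on the target site —
the representation fitting operators multiplied ON THE RIGHT, e.g. `G′∂*_μ`). [cite: Balaban1983RegularityDecay, (2.42) p.584; Balaban1984PropagatorsII, (2.51) p.232, Prop. 2.2 (2.67)₃ p.234; Balaban1985BackgroundPropagators, Thm 3.1 (3.42) p.397] -/
theorem hasMajorant_of_targetImages
    (hfit : ∀ μ, mir μ = true → nMir ℓ Mh k' m μ + sTop ℓ Mh k' ≤ (N0 ℓ Mh k P μ : ℤ))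
    (Xr Y : Finset ↥(boxDom (N0 ℓ Mh k' (Pref ℓ k k' P mir m))))
    (hXr : Xr ⊆ mirBoxClosed (N0 ℓ Mh k' (Pref ℓ k k' P mir m)) mir (nMir ℓ Mh k' m) (fun _ => hMir ℓ Mh k'))
    (hY : Y ⊆ mirBoxClosed (N0 ℓ Mh k' (Pref ℓ k k' P mir m)) mir (nMir ℓ Mh k' m) (fun _ => hMir ℓ Mh k'))
    (G : Matrix ↥(boxDom (N0 ℓ Mh k' (Pref ℓ k k' P mir m))) ↥(boxDom (N0 ℓ Mh k' (Pref ℓ k k' P mir m))) ℝ)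
    {φ : ℕ → ℝ} (hφ : ∀ j, 0 ≤ φ j) {δ : ℝ} (hδ : 0 ≤ δ)
    (hG : HasMajorant (g := geomT (reflected F k' mir m g hL hM hMh hP hk hlev hm hg)) (blkOf (reflected F k' mir m g hL hM hMh hP hk hlev hm hg).toDomains)
      (Matrix.toLin' G) (fun y y' => φ y.1.1 * Real.exp (-(δ * (geomT (reflected F k' mir m g hL hM hMh hP hk hlev hm hg)).dist y y'))))
    (T : Module.End ℝ (↥(boxDom (N0 ℓ Mh k P)) → ℝ))
    (hrow : ∀ f (z : ↥(boxDom (N0 ℓ Mh k P))), (∀ x ∈ Xr, B6MultiLevelTorusMirrorL0.emb (ℓ := ℓ) (Mh := Mh) (k := k) (P := P) g x.1 ≠ z.1) → T f z = 0)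
    (htgt : ∀ f, ∀ x ∈ Xr, T f ⟨B6MultiLevelTorusMirrorL0.emb (ℓ := ℓ) (Mh := Mh) (k := k) (P := P) g x.1, emb_mem hMh hP g x.1⟩ =
      ∑ ε ∈ mirIdx mir, tsign ℝ mir ε * (G *ᵥ pullY (k := k) (P := P) hMh hP g Y f) (trefl (hmir_of_top (k := k) (k' := k') (P := P) hL hM hMh hm) ε x)) :
    HasMajorant (g := geomT F) (blkOf F.toDomains) T (fun y y' => (mirIdx mir).card * φ y.1.1 * Real.exp (-(δ * (geomT F).dist y y'))) := by
  classical
  intro y' f B hf z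
  have hRHS : 0 ≤ (mirIdx mir).card * φ (blkOf F.toDomains z).1.1 * Real.exp (-(δ * (geomT F).dist (blkOf F.toDomains z) y')) * B :=
    mul_nonneg (mul_nonneg (mul_nonneg (Nat.cast_nonneg _) (hφ _)) (Real.exp_nonneg _)) hf.nonneg
  by_cases hz : ∃ x ∈ Xr, B6MultiLevelTorusMirrorL0.emb (ℓ := ℓ) (Mh := Mh) (k := k) (P := P) g x.1 = z.1
  swap
  · rw [hrow f z (fun x hx he => hz ⟨x, hx, he⟩), abs_zero]; exact hRHS
  obtain ⟨x, hx, hxz⟩ := hz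
  have hz' : z = ⟨B6MultiLevelTorusMirrorL0.emb (ℓ := ℓ) (Mh := Mh) (k := k) (P := P) g x.1, emb_mem hMh hP g x.1⟩ := Subtype.ext hxz.symm
  subst hz'
  rw [htgt f x hx]
  by_cases h0 : ∀ y ∈ Y, pullY (k := k) (P := P) hMh hP g Y f y = 0
  · have hzero : (pullY (k := k) (P := P) hMh hP g Y f) = 0 := by
      funext y; by_cases hy : y ∈ Y
      · exact h0 y hy
      · exact pullY_of_not_mem f hy
    simp only [hzero, Matrix.mulVec_zero, Pi.zero_apply, mul_zero, Finset.sum_const_zero, abs_zero]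
    exact hRHS
  obtain ⟨y₀, hy₀, hfy₀⟩ : ∃ y₀ ∈ Y, pullY (k := k) (P := P) hMh hP g Y f y₀ ≠ 0 := by
    by_contra hc; push Not at hc; exact h0 hc
  obtain ⟨hbs, hΨ⟩ := blockSupp_pullY (hL := hL) (hM := hM) (hMh := hMh) (hP := hP) (hk := hk) (hlev := hlev) (hm := hm) (hg := hg) hfit hY hf hy₀ hfy₀
  set t' := blkOf (reflected F k' mir m g hL hM hMh hP hk hlev hm hg).toDomains y₀ with ht'
  have hxc := hXr hx
  have hterm : ∀ ε ∈ mirIdx mir, |tsign ℝ mir ε * (G *ᵥ pullY (k := k) (P := P) hMh hP g Y f) (trefl (hmir_of_top (k := k) (k' := k') (P := P) hL hM hMh hm) ε x)| ≤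
      φ (blkOf F.toDomains ⟨B6MultiLevelTorusMirrorL0.emb (ℓ := ℓ) (Mh := Mh) (k := k) (P := P) g x.1, emb_mem hMh hP g x.1⟩).1.1 *
        Real.exp (-(δ * (geomT F).dist (blkOf F.toDomains ⟨B6MultiLevelTorusMirrorL0.emb (ℓ := ℓ) (Mh := Mh) (k := k) (P := P) g x.1, emb_mem hMh hP g x.1⟩) y')) * B := by
    intro ε _
    set sε := blkOf (reflected F k' mir m g hL hM hMh hP hk hlev hm hg).toDomains (trefl (hmir_of_top (k := k) (k' := k') (P := P) hL hM hMh hm) ε x) with hsε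
    have hc := hG t' _ B hbs (trefl (hmir_of_top (k := k) (k' := k') (P := P) hL hM hMh hm) ε x)
    rw [Matrix.toLin'_apply] at hc
    -- the level of the image row is the level of the row
    have hlev_eq : sε.1.1 = (blkOf F.toDomains ⟨B6MultiLevelTorusMirrorL0.emb (ℓ := ℓ) (Mh := Mh) (k := k) (P := P) g x.1, emb_mem hMh hP g x.1⟩).1.1 := by
      rw [hsε]; simp only [blkOf_val, TDomains.toDomains_lev, reflected_lev]
      rw [levR_trefl]; exact levR_of_mem_closed hxc
    -- fold the distance: `d_F(blk(emb x), y′) = d_F(Ψ(σ_ε s), Ψ t′) ≤ d_{F′}(σ_ε s, t′)`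
    have hd : (geomT F).dist (blkOf F.toDomains ⟨B6MultiLevelTorusMirrorL0.emb (ℓ := ℓ) (Mh := Mh) (k := k) (P := P) g x.1, emb_mem hMh hP g x.1⟩) y' ≤
        (geomT (reflected F k' mir m g hL hM hMh hP hk hlev hm hg)).dist sε t' := by
      have h1 := dist_blkPsi_le (F := F) (hL := hL) (hM := hM) (hMh := hMh) (hP := hP) (hk := hk) (hlev := hlev) (hm := hm) (hg := hg) sε t'
      rw [hsε, ht', blkPsi_trefl, blkPsi_blkOf_of_mem_closed hxc, hΨ] at h1
      show ((bondT F).dist _ y' : ℝ) ≤ ((bondT (reflected F k' mir m g hL hM hMh hP hk hlev hm hg)).dist sε t' : ℝ)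
      rw [hsε, ht']
      exact_mod_cast h1
    rw [abs_mul]
    calc |tsign ℝ mir ε| * |(G *ᵥ pullY (k := k) (P := P) hMh hP g Y f) (trefl (hmir_of_top (k := k) (k' := k') (P := P) hL hM hMh hm) ε x)|
        ≤ 1 * (φ sε.1.1 * Real.exp (-(δ * (geomT (reflected F k' mir m g hL hM hMh hP hk hlev hm hg)).dist sε t')) * B) :=
          mul_le_mul (abs_tsign_le ε) hc (abs_nonneg _) zero_le_one
      _ ≤ _ := by
          rw [one_mul, ← hlev_eq]
          apply mul_le_mul_of_nonneg_right _ hf.nonneg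
          apply mul_le_mul_of_nonneg_left _ (hφ _)
          apply Real.exp_le_exp.2
          have := mul_le_mul_of_nonneg_left hd hδ
          linarith
  calc |∑ ε ∈ mirIdx mir, tsign ℝ mir ε * (G *ᵥ pullY (k := k) (P := P) hMh hP g Y f) (trefl (hmir_of_top (k := k) (k' := k') (P := P) hL hM hMh hm) ε x)|
      ≤ ∑ ε ∈ mirIdx mir, |tsign ℝ mir ε * (G *ᵥ pullY (k := k) (P := P) hMh hP g Y f) (trefl (hmir_of_top (k := k) (k' := k') (P := P) hL hM hMh hm) ε x)| :=
        Finset.abs_sum_le_sum_abs _ _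
    _ ≤ ∑ ε ∈ mirIdx mir, φ (blkOf F.toDomains ⟨B6MultiLevelTorusMirrorL0.emb (ℓ := ℓ) (Mh := Mh) (k := k) (P := P) g x.1, emb_mem hMh hP g x.1⟩).1.1 *
        Real.exp (-(δ * (geomT F).dist (blkOf F.toDomains ⟨B6MultiLevelTorusMirrorL0.emb (ℓ := ℓ) (Mh := Mh) (k := k) (P := P) g x.1, emb_mem hMh hP g x.1⟩) y')) * B :=
        Finset.sum_le_sum hterm
    _ = _ := by rw [Finset.sum_const, nsmul_eq_mul]; ring

end Fold

end

end Literature.MathematicalPhysics.QuantumFieldTheory.Balaban1983to89.B6MultiLevelTorusMirrorImageFold
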